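import Summits.AtomisticToContinuum.Crystallization.Theorems.ChargedEnergyGapPhiEnvelope
import HarnessLib

/-!
# ChargedEnergyGap · NODE 97 «PhiConvex» — the depth profile `φ = depthProfile 160` is CONVEX on `[80, 134]`; exact chord / secant envelopes (L3, second order)

decomp-a2c lens-3 g90 (FINDING «ENV-ORDER»: first-order staircase envelopes lose `φ′·h` per grid step — ≈ 25 c_T at the pilot's grid — so the census
and the L5 replay need SECOND-ORDER envelopes; this node supplies the one analytic input).  Imports tree …ChargedEnergyGapPhiEnvelope (p855277) + HarnessLib.

§97.1 Polynomial forms: `sPoly x = x⁴(35 − 84x + 70x² − 20x³)` (= `smoothStep` on `[0,1]`), `phiPoly d = (1 − sPoly (2 − 2d/160))⁴` (= `depthProfile 160` on `[80,160]`).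
§97.2 Derivatives: `sPoly′ = 140x³(1−x)³`; `phiPoly′ = phiD1`, `phiD1′ = phiD2` with the FACTORED second derivative
  `phiD2 d = (21/80)·(1 − S u)²·u²·(1 − u)²·[140u⁴(1−u)⁴ − (1 − 2u)(1 − S u)]`, `u = 2 − 2d/160` (all by `HasDerivAt` calculus + `ring`).
§97.3 Sign: the bracket is `≥ 0` for `u ≥ 1/2` trivially and `≥ P(13/40) > 0` on `u ∈ [13/40, 1/2]` by monotone comparison (`smoothStep_mono`), i.e. for `d ≤ 134`
  (the exact convexity threshold is `d* = 134.5698…`, root of the bracket); hence `phiD2 ≥ 0` on `(80, 134)`.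
§97.4 ★★★ `depthProfile_convexOn : ConvexOn ℝ (Set.Icc 80 134) (depthProfile 160)` (Mathlib `convexOn_of_hasDerivWithinAt2_nonneg` + `ConvexOn.congr`).
§97.5 The two EXACT affine envelopes every «env2» certificate row uses (generic over any `ConvexOn ℝ s f`): CHORD upper bound on `[x, z]` and SECANT-EXTENSION lower
  bound beyond `[a, lo]` — three-point convexity, no derivatives, no grid, no δ; specialised to `φ` on `[80,134]`.

[SUPPORT node: all PROVED, 0 sorry; 4 defs (`sPoly`, `phiPoly`, `phiD1`, `phiD2`), 17 theorems; no cone statement touched; no `set_option`; 213 lines.] -/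

noncomputable section
open scoped Classical
open Literature.MathematicalPhysics.StatisticalMechanics Literature.Geometry.DiscreteGeometry
open Summit.AtomisticToContinuum.Crystallization.Theses.PricedLinkCensus
open Summit.AtomisticToContinuum.Crystallization.Theorems.ChargedEnergyGapNegative

namespace Summit.AtomisticToContinuum.Crystallization.Theorems.ChargedEnergyGapChartDial

/-! ## §97.1 Polynomial forms -/

/-- ★ The smooth-step polynomial (the tree's `smoothStep` without its clamp). -/
def sPoly (x : ℝ) : ℝ := x ^ 4 * (35 - 84 * x + 70 * x ^ 2 - 20 * x ^ 3)

/-- ★ The polynomial form of `depthProfile 160` (valid on `80 ≤ d ≤ 160`). -/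
def phiPoly (d : ℝ) : ℝ := (1 - sPoly (2 - 2 * d / 160)) ^ 4

/-- [formal bookkeeping] `smoothStep = sPoly` on `[0, 1]`. -/
theorem smoothStep_eq_sPoly {x : ℝ} (h0 : 0 ≤ x) (h1 : x ≤ 1) : smoothStep x = sPoly x := by
  simp [smoothStep, sPoly, min_eq_right h1, max_eq_right h0]

/-- [formal bookkeeping] `depthProfile 160 = phiPoly` on `[80, 160]`. -/
theorem depthProfile_eq_phiPoly {d : ℝ} (h0 : 80 ≤ d) (h1 : d ≤ 160) : depthProfile 160 d = phiPoly d := by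
  have hx0 : 0 ≤ 2 - 2 * d / 160 := by linarith
  have hx1 : 2 - 2 * d / 160 ≤ 1 := by linarith
  rw [depthProfile, smoothStep_eq_sPoly hx0 hx1, phiPoly]

/-- `0 ≤ sPoly u ≤ 1` on `[0,1]` (from the tree's `smoothStep` bounds). -/
theorem sPoly_mem {u : ℝ} (h0 : 0 ≤ u) (h1 : u ≤ 1) : 0 ≤ sPoly u ∧ sPoly u ≤ 1 := by
  rw [← smoothStep_eq_sPoly h0 h1]; exact ⟨smoothStep_nonneg u, smoothStep_le_one u⟩

/-- `sPoly` is monotone on `[0,1]` (from the tree's `smoothStep_mono`). -/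
theorem sPoly_mono {u v : ℝ} (hu : 0 ≤ u) (huv : u ≤ v) (hv : v ≤ 1) : sPoly u ≤ sPoly v := by
  rw [← smoothStep_eq_sPoly hu (le_trans huv hv), ← smoothStep_eq_sPoly (le_trans hu huv) hv]; exact smoothStep_mono huv

/-! ## §97.2 Derivatives -/

/-- ★ `sPoly′(x) = 140 x³ (1 − x)³`. -/
theorem hasDerivAt_sPoly (x : ℝ) : HasDerivAt sPoly (140 * x ^ 3 * (1 - x) ^ 3) x := by
  have h1 : HasDerivAt (fun x : ℝ => x ^ 4) (4 * x ^ 3) x := by simpa using hasDerivAt_pow 4 x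
  have b : HasDerivAt (fun x : ℝ => x ^ 2) (2 * x) x := by simpa using hasDerivAt_pow 2 x
  have c : HasDerivAt (fun x : ℝ => x ^ 3) (3 * x ^ 2) x := by simpa using hasDerivAt_pow 3 x
  have a := (hasDerivAt_id' x).const_mul (84 : ℝ)
  have h2 := (((hasDerivAt_const x (35 : ℝ)).fun_sub a).fun_add (b.const_mul 70)).fun_sub (c.const_mul 20)
  have h := h1.fun_mul h2
  unfold sPoly
  exact h.congr_deriv (by ring)

/-- [formal bookkeeping] the inner affine map `u(d) = 2 − 2d/160`, `u′ = −1/80`. -/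
theorem hasDerivAt_uAff (d : ℝ) : HasDerivAt (fun d : ℝ => 2 - 2 * d / 160) (-(1 / 80)) d := by
  have h := (hasDerivAt_const d (2 : ℝ)).fun_sub (((hasDerivAt_id' d).const_mul (2 : ℝ)).div_const 160)
  exact h.congr_deriv (by ring)

/-- [formal bookkeeping] chain rule for `sPoly ∘ u`. -/
theorem hasDerivAt_sPoly_u (d : ℝ) :
    HasDerivAt (fun d : ℝ => sPoly (2 - 2 * d / 160)) (140 * (2 - 2 * d / 160) ^ 3 * (1 - (2 - 2 * d / 160)) ^ 3 * (-(1 / 80))) d := by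
  have h := (hasDerivAt_sPoly (2 - 2 * d / 160)).comp d (hasDerivAt_uAff d)
  exact h

/-- ★ First derivative of `phiPoly` (factored): `7 (1 − S u)³ u³ (1 − u)³`, `u = 2 − 2d/160`. -/
def phiD1 (d : ℝ) : ℝ :=
  7 * ((1 - sPoly (2 - 2 * d / 160)) ^ 3 * (2 - 2 * d / 160) ^ 3 * (1 - (2 - 2 * d / 160)) ^ 3)

/-- ★ Second derivative of `phiPoly` (factored): `(21/80)(1 − S u)² u² (1 − u)² · [140 u⁴ (1−u)⁴ − (1 − 2u)(1 − S u)]`. -/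
def phiD2 (d : ℝ) : ℝ :=
  21 / 80 * ((1 - sPoly (2 - 2 * d / 160)) ^ 2 * (2 - 2 * d / 160) ^ 2 * (1 - (2 - 2 * d / 160)) ^ 2) *
    (140 * (2 - 2 * d / 160) ^ 4 * (1 - (2 - 2 * d / 160)) ^ 4 - (1 - 2 * (2 - 2 * d / 160)) * (1 - sPoly (2 - 2 * d / 160)))

/-- ★★ `phiPoly′ = phiD1`. -/
theorem hasDerivAt_phiPoly (d : ℝ) : HasDerivAt phiPoly (phiD1 d) d := by
  have h := ((hasDerivAt_const d (1 : ℝ)).fun_sub (hasDerivAt_sPoly_u d)).fun_pow 4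
  unfold phiPoly
  refine h.congr_deriv ?_
  simp only [phiD1]
  norm_num
  ring

/-- ★★ `phiD1′ = phiD2`. -/
theorem hasDerivAt_phiD1 (d : ℝ) : HasDerivAt phiD1 (phiD2 d) d := by
  have hA := ((hasDerivAt_const d (1 : ℝ)).fun_sub (hasDerivAt_sPoly_u d)).fun_pow 3
  have hB := (hasDerivAt_uAff d).fun_pow 3
  have hC := ((hasDerivAt_const d (1 : ℝ)).fun_sub (hasDerivAt_uAff d)).fun_pow 3
  have h := ((hA.fun_mul hB).fun_mul hC).const_mul (7 : ℝ)
  unfold phiD1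
  refine h.congr_deriv ?_
  simp only [phiD2]
  norm_num
  ring

/-! ## §97.3 Sign of the second derivative on `(80, 134)` -/

/-- ★★ The bracket `P(u) = 140u⁴(1−u)⁴ − (1 − 2u)(1 − S u)` is non-negative for `13/40 ≤ u ≤ 1`
(`u ≥ 1/2`: both terms `≥ 0`; `u ≤ 1/2`: monotone comparison with the left end, `P(13/40) > 0`). -/
theorem bracket_nonneg {u : ℝ} (h0 : 13 / 40 ≤ u) (h1 : u ≤ 1) :
    0 ≤ 140 * u ^ 4 * (1 - u) ^ 4 - (1 - 2 * u) * (1 - sPoly u) := by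
  have hu0 : 0 ≤ u := by linarith
  obtain ⟨hS0, hS1⟩ := sPoly_mem hu0 h1
  by_cases hhalf : 1 / 2 ≤ u
  · have h4 : 0 ≤ 140 * u ^ 4 * (1 - u) ^ 4 := by positivity
    nlinarith
  · rw [not_le] at hhalf
    -- monotone comparison with u₀ = 13/40
    have hmono : sPoly (13 / 40) ≤ sPoly u := sPoly_mono (by norm_num) h0 h1
    have hprod : u * (1 - u) ≥ 13 / 40 * (27 / 40) := by nlinarith
    have hp0 : (0:ℝ) ≤ 13 / 40 * (27 / 40) := by norm_num
    have hpow : (13 / 40 * (27 / 40) : ℝ) ^ 4 ≤ (u * (1 - u)) ^ 4 := pow_le_pow_left₀ hp0 hprod 4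
    have hfac : (1 - 2 * u) * (1 - sPoly u) ≤ (1 - 2 * (13 / 40)) * (1 - sPoly (13 / 40)) :=
      mul_le_mul (by linarith) (by linarith) (by linarith) (by norm_num)
    have hval : (0:ℝ) ≤ 140 * (13 / 40 * (27 / 40)) ^ 4 - (1 - 2 * (13 / 40)) * (1 - sPoly (13 / 40)) := by
      norm_num [sPoly]
    calc (0:ℝ) ≤ 140 * (13 / 40 * (27 / 40)) ^ 4 - (1 - 2 * (13 / 40)) * (1 - sPoly (13 / 40)) := hval
      _ ≤ 140 * (u * (1 - u)) ^ 4 - (1 - 2 * u) * (1 - sPoly u) := by nlinarith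
      _ = 140 * u ^ 4 * (1 - u) ^ 4 - (1 - 2 * u) * (1 - sPoly u) := by ring

/-- ★★ `phiD2 d ≥ 0` for `80 ≤ d ≤ 134`. -/
theorem phiD2_nonneg {d : ℝ} (h0 : 80 ≤ d) (h1 : d ≤ 134) : 0 ≤ phiD2 d := by
  have hu0 : 13 / 40 ≤ 2 - 2 * d / 160 := by linarith
  have hu1 : 2 - 2 * d / 160 ≤ 1 := by linarith
  have hb := bracket_nonneg hu0 hu1
  have hsq : 0 ≤ (1 - sPoly (2 - 2 * d / 160)) ^ 2 * (2 - 2 * d / 160) ^ 2 * (1 - (2 - 2 * d / 160)) ^ 2 := by positivity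
  unfold phiD2
  exact mul_nonneg (mul_nonneg (by norm_num) hsq) hb

/-! ## §97.4 Convexity -/

/-- ★★ `phiPoly` is convex on `[80, 134]`. -/
theorem phiPoly_convexOn : ConvexOn ℝ (Set.Icc 80 134) phiPoly := by
  have hcont : Continuous phiPoly := by unfold phiPoly sPoly; fun_prop
  refine convexOn_of_hasDerivWithinAt2_nonneg (convex_Icc 80 134) hcont.continuousOn
    (fun x _ => (hasDerivAt_phiPoly x).hasDerivWithinAt) (fun x _ => (hasDerivAt_phiD1 x).hasDerivWithinAt) ?_
  intro x hx
  rw [interior_Icc] at hx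
  exact phiD2_nonneg hx.1.le hx.2.le

/-- ★★★ **THE DEPTH PROFILE IS CONVEX ON `[80, 134]`.** -/
theorem depthProfile_convexOn : ConvexOn ℝ (Set.Icc 80 134) (depthProfile 160) :=
  phiPoly_convexOn.congr fun d hd => (depthProfile_eq_phiPoly hd.1 (by linarith [hd.2])).symm

/-! ## §97.5 Exact affine envelopes from convexity (the «env2» rows) -/

/-- ★★ CHORD UPPER BOUND: for `f` convex on `s` and `x < z` in `s`, on `[x, z]`:
`f y ≤ f x + (f z − f x)/(z − x) · (y − x)`. -/
theorem chord_upper {s : Set ℝ} {f : ℝ → ℝ} (hf : ConvexOn ℝ s f) {x y z : ℝ} (hx : x ∈ s) (hz : z ∈ s)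
    (hxz : x < z) (hxy : x ≤ y) (hyz : y ≤ z) : f y ≤ f x + (f z - f x) / (z - x) * (y - x) := by
  have hzx : 0 < z - x := sub_pos.2 hxz
  set a := (z - y) / (z - x) with ha
  set b := (y - x) / (z - x) with hb
  have ha0 : 0 ≤ a := div_nonneg (by linarith) hzx.le
  have hb0 : 0 ≤ b := div_nonneg (by linarith) hzx.le
  have hab : a + b = 1 := by rw [ha, hb, ← add_div]; field_simp; ring
  have hy : a • x + b • z = y := by
    simp only [smul_eq_mul]; rw [ha, hb]; field_simp; ring
  have key := hf.2 hx hz ha0 hb0 hab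
  rw [hy] at key
  have e : a • f x + b • f z = f x + (f z - f x) / (z - x) * (y - x) := by
    simp only [smul_eq_mul]; rw [ha, hb]; field_simp; ring
  linarith [key, e.le, e.ge]

/-- ★★ SECANT-EXTENSION LOWER BOUND: for `f` convex on `s`, `a < lo` and `lo ≤ d`, all in `s`:
`f a + (f lo − f a)/(lo − a) · (d − a) ≤ f d` (the secant through `a, lo` extended beyond `lo` minorises `f`). -/
theorem secant_lower {s : Set ℝ} {f : ℝ → ℝ} (hf : ConvexOn ℝ s f) {a lo d : ℝ} (ha : a ∈ s) (hd : d ∈ s)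
    (halo : a < lo) (hlod : lo ≤ d) : f a + (f lo - f a) / (lo - a) * (d - a) ≤ f d := by
  rcases eq_or_lt_of_le hlod with rfl | hlt
  · have hla : lo - a ≠ 0 := by linarith
    field_simp
    ring_nf
    rfl
  · -- convexity at `lo` between `a` and `d`
    have hch := chord_upper hf ha hd (lt_trans halo hlt) halo.le hlt.le
    -- f lo ≤ f a + (f d − f a)/(d − a)·(lo − a)  ⇒  (f lo − f a)/(lo − a) ≤ (f d − f a)/(d − a)
    have hda : 0 < d - a := by linarith
    have hla : 0 < lo - a := sub_pos.2 halo
    have h1 : (f lo - f a) / (lo - a) ≤ (f d - f a) / (d - a) := by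
      rw [div_le_div_iff₀ hla hda]
      have := mul_le_mul_of_nonneg_right (sub_le_iff_le_add'.2 hch) hda.le
      have e : (f d - f a) / (d - a) * (lo - a) * (d - a) = (f d - f a) * (lo - a) := by field_simp
      nlinarith [this, e]
    have h2 : (f lo - f a) / (lo - a) * (d - a) ≤ (f d - f a) / (d - a) * (d - a) := mul_le_mul_of_nonneg_right h1 hda.le
    have e2 : (f d - f a) / (d - a) * (d - a) = f d - f a := by field_simp
    linarith

/-- ★★★ «env2» UPPER ROW for `φ`: the chord of `φ = depthProfile 160` over `[lo, hi] ⊆ [80, 134]` majorises `φ` on `[lo, hi]`. -/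
theorem depthProfile_chord_upper {lo hi : ℝ} (hlo : 80 ≤ lo) (hhi : hi ≤ 134) (hlt : lo < hi) :
    ∀ d, lo ≤ d → d ≤ hi → depthProfile 160 d ≤ depthProfile 160 lo + (depthProfile 160 hi - depthProfile 160 lo) / (hi - lo) * (d - lo) :=
  fun _ h1 h2 => chord_upper depthProfile_convexOn ⟨hlo, by linarith⟩ ⟨by linarith, hhi⟩ hlt h1 h2

/-- ★★★ «env2» LOWER ROW for `φ`: the secant of `φ` through `a < lo` (both `≥ 80`) minorises `φ` on `[lo, hi] ⊆ [80, 134]`. -/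
theorem depthProfile_secant_lower {a lo hi : ℝ} (ha : 80 ≤ a) (halo : a < lo) (hhi : hi ≤ 134) :
    ∀ d, lo ≤ d → d ≤ hi → depthProfile 160 a + (depthProfile 160 lo - depthProfile 160 a) / (lo - a) * (d - a) ≤ depthProfile 160 d :=
  fun _ h1 h2 => secant_lower depthProfile_convexOn ⟨ha, by linarith⟩ ⟨by linarith, by linarith⟩ halo h1

end Summit.AtomisticToContinuum.Crystallization.Theorems.ChargedEnergyGapChartDial

end
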